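import Summits.AtomisticToContinuum.FouriersLaw.Theorems.VanishingNoiseTransferNoisyFourierOfKuboLimit
import Summits.AtomisticToContinuum.FouriersLaw.Theorems.VanishingNoiseTransferNoisyFourierAbelCorrectorExists
import Summits.AtomisticToContinuum.FouriersLaw.Theorems.VanishingNoiseTransferNoisyFourierAbelLimit
import Summits.AtomisticToContinuum.FouriersLaw.Theorems.VanishingNoiseTransferNoisyFourierAbelMonotone
import Summits.AtomisticToContinuum.FouriersLaw.Theorems.VanishingNoiseTransferNoisyFourierStorageDecayRealAnalysis
import Literature.MathematicalPhysics.KineticTheory.VelocityFlipNoise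
import HarnessLib

/-!
# Zero-frequency storage decay ⇒ upper Abel modulus, part 2: the composition of line `abel-storage-decay`
# (crux `VanishingNoiseTransfer.NoisyFourier`, stmt-AtomisticToContinuum-11977)

`--supports stmt-AtomisticToContinuum-11977` file (lead c6; statements and proofs from the crux workfile
`Cruxes/NoisyFourier/Lines/abel_storage_decay.lean` of the crux-strategist seat s3 / lead c5, landed so that the
skeleton of the line is imports + its three registered stubs, and so that the strategist's certified split
{U⁺ (or U), P, A4} of the crux has LANDED glue).

Setting as in `…NoisyFourierAbelTransfer`: pinned anharmonic chain `𝐏 = pinnedChain ω₂ lam β γ` (parameters `> 0`),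
`T > 0`, Gibbs measure `μ_T`, flip-noisy equilibrium generator `L_ε = 𝐏.flipGenerator L T T ε` (`ε > 0`), total
current `J = Σ_i j_i`, CLASSICAL Abel correctors `u ∈ C² ∩ L²(μ_T)` with `L_ε u = s u − J` pointwise (`s > 0`;
they exist, landed A2 `stub_abelCorrectorExists` p133524), the Abel–Green–Kubo pairing `σ_L(s) = ∫ J u_{L,s} dμ_T`
(corrector-independent, `resolvent_identity`), its fixed-`L` Abel limit `σ_L(0⁺) = T²(L−1)·(L−1)G_L` (landed A3
`stub_abelLimit` p133374) and its free one-sided monotonicity (landed M `stub_abelMonotone` p135142).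

* `upperAbelModulus_of_storageDecay` — U⁺ ⇒ U: zero-frequency storage decay `s·∫u_{L,s}² ≤ C(L−1)s^a`
  (`a ∈ (0,1]`, all `L ≥ 2`, `s ∈ (0,1]`) implies the `L`-uniform upper Abel modulus at `0⁺`,
  `σ_L(s') − σ_L(s) ≤ η(L−1)` for `0 < s ≤ s' ≤ s₀(η)` (Cauchy–Schwarz on `resolvent_identity`, `Π`-invariance of
  `μ_T`, the real-analysis telescope `telescope_le` of part 1);
* `kuboLimit_of_storageDecayParts` — A4 (fixed-`s` thermodynamic limit) → U⁺ → P (uniform positivity of the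
  finite-volume Kubo conductance) → the finite-volume Green–Kubo limit of the flip chain in exactly the form
  consumed by the landed closer `noisyFourier_of_kuboLimit` (p127584);
* `noisyFourier_of_storageDecayParts` — A4 → U⁺ → P → `VanishingNoiseTransfer.NoisyFourier` BY NAME;
* `helper_noisyFourierOfStorageDecayParts` — registered notation-free restatement.

References: Bernardin–Olla 2011 (J. Stat. Phys. 145) §3, §5 (Thm 2: the soft, fixed-volume form of
`λ‖u_λ‖² → 0`); folklore real analysis. No definitions; axioms `propext`, `Classical.choice`, `Quot.sound` only.
-/

noncomputable section

open MeasureTheory Filter Topology Finset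
open scoped BigOperators

namespace Summit.AtomisticToContinuum.FouriersLaw.Theorems.NoisyFourier.StorageDecay

open Literature.MathematicalPhysics.KineticTheory.HeatConduction
open Summit.AtomisticToContinuum.FouriersLaw.Theses.VanishingNoiseTransfer (NoisyFourier)
open Summit.AtomisticToContinuum.FouriersLaw.Theorems.SuperadditiveResistance.DeviceLiouville (kin)
open Summit.AtomisticToContinuum.FouriersLaw.Theorems.SuperadditiveResistance.Kubo (memLp_rev)
open Summit.AtomisticToContinuum.FouriersLaw.Theorems.OddResponseBound.Negative.OddPairing (sq_integral_mul_le)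
open Summit.AtomisticToContinuum.FouriersLaw.Cruxes.NoisyFourier.AbelKapitzaEvenCorrector
  (stub_abelCorrectorExists stub_abelLimit stub_abelMonotone)
open Summit.AtomisticToContinuum.FouriersLaw.Cruxes.NoisyFourier.AbelKapitzaEvenCorrector.AbelTransfer
  (memLp_totalCurrent resolvent_identity integral_rev_gibbsMeasure totalCurrent_neg_momentum)

/-! ## `U⁺ ⇒ U`: zero-frequency storage decay implies the upper Abel modulus -/

/-- **Storage decay ⇒ upper Abel modulus.** If `s·∫u_{L,s}² ≤ C(L−1)s^a` for all `L ≥ 2`, `s ∈ (0,1]` (some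
`a ∈ (0,1]`, `C ≥ 0`), then the live line's open stub U holds, with `L₀ = 0` and `s₀ = min(1, (ηa/(2C+1))^{1/a})`:
Cauchy–Schwarz on the landed `resolvent_identity` gives `(σ(t') − σ(t))² ≤ (t'−t)²‖u_t‖²‖u_{t'}‖²` for correctors chosen
at every level (landed A2; `Π`-invariance of `μ_T`), and `telescope_le` does the rest; the endpoints are arbitrary correctors
by corrector-independence of `σ` (`resolvent_identity` at equal parameters). [folklore] -/
theorem upperAbelModulus_of_storageDecay
    (hSD : ∀ (ω₂ lam β γ T ε : ℝ), 0 < ω₂ → 0 < lam → 0 < β → 0 < γ → 0 < T → 0 < ε →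
      ∃ a C : ℝ, 0 < a ∧ a ≤ 1 ∧ 0 ≤ C ∧ ∀ (L : ℕ), 2 ≤ L → ∀ s : ℝ, 0 < s → s ≤ 1 →
        ∀ u : PhaseSpace L → ℝ,
          (ContDiff ℝ 2 u ∧ MemLp u 2 ((pinnedChain ω₂ lam β γ).gibbsMeasure L T) ∧
            ∀ x, (pinnedChain ω₂ lam β γ).flipGenerator L T T ε u x =
              s * u x - ∑ i : Fin L, (pinnedChain ω₂ lam β γ).bondCurrent L i x) →
          s * ∫ x, u x ^ 2 ∂((pinnedChain ω₂ lam β γ).gibbsMeasure L T) ≤ C * ((L : ℝ) - 1) * s ^ a) :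
    ∀ (ω₂ lam β γ T ε : ℝ), 0 < ω₂ → 0 < lam → 0 < β → 0 < γ → 0 < T → 0 < ε → ∀ η : ℝ, 0 < η →
      ∃ s₀ : ℝ, 0 < s₀ ∧ s₀ ≤ 1 ∧ ∃ L₀ : ℕ, ∀ (L : ℕ), L₀ ≤ L → 2 ≤ L → ∀ s s' : ℝ, 0 < s → s ≤ s' → s' ≤ s₀ →
        ∀ u u' : PhaseSpace L → ℝ,
          (ContDiff ℝ 2 u ∧ MemLp u 2 ((pinnedChain ω₂ lam β γ).gibbsMeasure L T) ∧
            ∀ x, (pinnedChain ω₂ lam β γ).flipGenerator L T T ε u x =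
              s * u x - ∑ i : Fin L, (pinnedChain ω₂ lam β γ).bondCurrent L i x) →
          (ContDiff ℝ 2 u' ∧ MemLp u' 2 ((pinnedChain ω₂ lam β γ).gibbsMeasure L T) ∧
            ∀ x, (pinnedChain ω₂ lam β γ).flipGenerator L T T ε u' x =
              s' * u' x - ∑ i : Fin L, (pinnedChain ω₂ lam β γ).bondCurrent L i x) →
          (∫ x, (∑ i : Fin L, (pinnedChain ω₂ lam β γ).bondCurrent L i x) * u' x ∂((pinnedChain ω₂ lam β γ).gibbsMeasure L T)) -
            ∫ x, (∑ i : Fin L, (pinnedChain ω₂ lam β γ).bondCurrent L i x) * u x ∂((pinnedChain ω₂ lam β γ).gibbsMeasure L T)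
            ≤ η * ((L : ℝ) - 1) := by
  intro ω₂ lam β γ T ε hω hl hβ hγ hT hε η hη
  obtain ⟨a, C, ha, ha1, hC, hSD'⟩ := hSD ω₂ lam β γ T ε hω hl hβ hγ hT hε
  -- the threshold `s₀`
  set q : ℝ := η * a / (2 * C + 1) with hq
  have hq0 : 0 < q := by positivity
  set s₀ : ℝ := min 1 (q ^ (1 / a)) with hs₀
  have hs₀0 : 0 < s₀ := lt_min one_pos (Real.rpow_pos_of_pos hq0 _)
  have hs₀1 : s₀ ≤ 1 := min_le_left _ _
  have hs₀a : s₀ ^ a ≤ q := by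
    have h1 : s₀ ≤ q ^ (1 / a) := min_le_right _ _
    calc s₀ ^ a ≤ (q ^ (1 / a)) ^ a := Real.rpow_le_rpow hs₀0.le h1 ha.le
      _ = q := by rw [← Real.rpow_mul hq0.le, one_div_mul_cancel ha.ne', Real.rpow_one]
  refine ⟨s₀, hs₀0, hs₀1, 0, fun L _ hL s s' hs hss' hs'₀ u u' hu hu' => ?_⟩
  classical
  set P := pinnedChain ω₂ lam β γ with hP
  set μ := P.gibbsMeasure L T with hμ
  have hs' : 0 < s' := lt_of_lt_of_le hs hss'
  have hs'1 : s' ≤ 1 := hs'₀.trans hs₀1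
  -- correctors at every level (landed A2), junk off `t > 0`
  have hA2 := stub_abelCorrectorExists ω₂ lam β γ T ε hω hl hβ hγ hT hε
  set uc : ℝ → PhaseSpace L → ℝ := fun t => if h : 0 < t then (hA2 L hL t h).choose else fun _ => 0
    with hucdef
  have huc : ∀ t : ℝ, 0 < t → ContDiff ℝ 2 (uc t) ∧ MemLp (uc t) 2 μ ∧
      ∀ x, P.flipGenerator L T T ε (uc t) x = t * uc t x - ∑ i : Fin L, P.bondCurrent L i x := by
    intro t ht
    have e : uc t = (hA2 L hL t ht).choose := by simp only [hucdef, dif_pos ht]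
    rw [e]
    exact (hA2 L hL t ht).choose_spec
  -- the current
  set J : PhaseSpace L → ℝ := fun x => ∑ i, P.bondCurrent L i x with hJ
  have hJ2 : MemLp J 2 μ := memLp_totalCurrent hω hl.le hβ.le γ L hT
  have hJodd : ∀ x : PhaseSpace L, J (x.1, -x.2) = -J x := totalCurrent_neg_momentum P
  -- the two sequences of the telescope
  set σ : ℝ → ℝ := fun t => ∫ x, J x * uc t x ∂μ with hσ
  set N : ℝ → ℝ := fun t => ∫ x, uc t x ^ 2 ∂μ with hN
  have hNb : ∀ t, 0 < t → t ≤ 1 → t * N t ≤ C * ((L : ℝ) - 1) * t ^ a := fun t ht ht1 =>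
    hSD' L hL t ht ht1 (uc t) (huc t ht)
  have hN0 : ∀ t, 0 < t → t ≤ 1 → 0 ≤ N t := fun t _ _ => integral_nonneg fun x => sq_nonneg _
  have hstep : ∀ t t', 0 < t → t ≤ t' → t' ≤ 1 →
      (σ t' - σ t) ^ 2 ≤ (t' - t) ^ 2 * (N t * N t') := by
    intro t t' ht htt' _
    have ht' : 0 < t' := lt_of_lt_of_le ht htt'
    obtain ⟨hC1, hM1, hp1⟩ := huc t ht
    obtain ⟨hC2, hM2, hp2⟩ := huc t' ht'
    have hres : σ t - σ t' = (t - t') * ∫ x, uc t x * uc t' (x.1, -x.2) ∂μ :=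
      resolvent_identity hω hl hβ hγ hT ε hJ2 hJodd hC1 hM1 hp1 hC2 hM2 hp2
    have hrev2 : MemLp (fun x : PhaseSpace L => uc t' (x.1, -x.2)) 2 μ :=
      memLp_rev hω hl.le hβ.le L hT hC2.continuous hM2
    have hCS : (∫ x, uc t x * uc t' (x.1, -x.2) ∂μ) ^ 2 ≤
        N t * ∫ x, (uc t' (x.1, -x.2)) ^ 2 ∂μ := sq_integral_mul_le hM1 hrev2
    have hrevN : ∫ x, (uc t' (x.1, -x.2)) ^ 2 ∂μ = N t' :=
      integral_rev_gibbsMeasure P T (fun x => uc t' x ^ 2)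
    rw [hrevN] at hCS
    have e : σ t' - σ t = (t' - t) * ∫ x, uc t x * uc t' (x.1, -x.2) ∂μ := by
      have : σ t' - σ t = -(σ t - σ t') := by ring
      rw [this, hres]
      ring
    rw [e, mul_pow]
    exact mul_le_mul_of_nonneg_left hCS (sq_nonneg _)
  -- the bound `≤ η (L − 1)`
  have hL1 : (0 : ℝ) ≤ (L : ℝ) - 1 := by
    have : (2 : ℝ) ≤ L := by exact_mod_cast hL
    linarith
  have hCL : 0 ≤ C * ((L : ℝ) - 1) := mul_nonneg hC hL1
  have hmain : σ s' - σ s ≤ 2 * (C * ((L : ℝ) - 1)) / a * s' ^ a :=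
    telescope_le ha ha1 hCL hNb hN0 hstep hs hss' hs'1
  have hfin : σ s' - σ s ≤ η * ((L : ℝ) - 1) := by
    refine hmain.trans ?_
    have h1 : s' ^ a ≤ q := (Real.rpow_le_rpow hs'.le hs'₀ ha.le).trans hs₀a
    have h2 : 2 * (C * ((L : ℝ) - 1)) / a * s' ^ a ≤ 2 * (C * ((L : ℝ) - 1)) / a * q :=
      mul_le_mul_of_nonneg_left h1 (div_nonneg (mul_nonneg (by norm_num) hCL) ha.le)
    refine h2.trans ?_
    have e : 2 * (C * ((L : ℝ) - 1)) / a * q = (2 * C / (2 * C + 1)) * (η * ((L : ℝ) - 1)) := by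
      rw [hq]
      field_simp
    rw [e]
    have h3 : 2 * C / (2 * C + 1) ≤ 1 := (div_le_one (by positivity)).2 (by linarith)
    exact mul_le_of_le_one_left (mul_nonneg hη.le hL1) h3
  -- endpoint correctors are arbitrary: corrector-independence of the pairing
  obtain ⟨huC, hu2, hup⟩ := hu
  obtain ⟨hu'C, hu'2, hu'p⟩ := hu'
  obtain ⟨hc1, hm1, hq1⟩ := huc s hs
  obtain ⟨hc2, hm2, hq2⟩ := huc s' hs'
  have e1 : (∫ x, J x * u x ∂μ) - ∫ x, J x * uc s x ∂μ = (s - s) * ∫ x, u x * uc s (x.1, -x.2) ∂μ :=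
    resolvent_identity hω hl hβ hγ hT ε hJ2 hJodd huC hu2 hup hc1 hm1 hq1
  have e2 : (∫ x, J x * u' x ∂μ) - ∫ x, J x * uc s' x ∂μ = (s' - s') * ∫ x, u' x * uc s' (x.1, -x.2) ∂μ :=
    resolvent_identity hω hl hβ hγ hT ε hJ2 hJodd hu'C hu'2 hu'p hc2 hm2 hq2
  rw [sub_self, zero_mul, sub_eq_zero] at e1 e2
  have hσs : σ s = ∫ x, J x * uc s x ∂μ := rfl
  have hσs' : σ s' = ∫ x, J x * uc s' x ∂μ := rfl
  calc (∫ x, J x * u' x ∂μ) - ∫ x, J x * u x ∂μ = σ s' - σ s := by rw [hσs, hσs', e1, e2]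
    _ ≤ η * ((L : ℝ) - 1) := hfin

/-! ## Composition -/

/-- **The line, composed**: the three registered stubs A4 (`hA4`), U⁺ (`hSD`), P (`hFloor`) give the finite-volume Green–Kubo limit of the flip
chain in exactly the form consumed by the landed closer `noisyFourier_of_kuboLimit`: for all parameters, `T, ε > 0`
there is `κ > 0` such that `(L−1)·γ(1 − (γ/T²)∫ g_L (p_0² − T) dμ_T) → κ` for every family of classical forward
fields `g`. Proof: choose classical Abel correctors `u_{L,s}` (A2, landed) and set
`K_L(s) := ∫ J_L u_{L,s} dμ_T /(T²(L−1))`; by A3 (landed) `K_L(0⁺) = (L−1)G_L[g_L]` for EVERY forward field; by M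
(landed) `K_L` is one-sidedly monotone with constant `2C₀/T²`, by U⁺ ⇒ U (`upperAbelModulus_of_storageDecay`) it has an `L`-uniform upper modulus at `0⁺`, by
A4 it converges at each fixed `s`, by P the Abel limits are eventually `≥ c > 0`; `abel_mooreOsgood_floorD` concludes.
If for some `L ≥ 2` no forward field exists the `∀ g` clause is vacuous. [folklore] -/
theorem kuboLimit_of_storageDecayParts
    (hA4 : ∀ (ω₂ lam β γ T ε : ℝ), 0 < ω₂ → 0 < lam → 0 < β → 0 < γ → 0 < T → 0 < ε →
      ∀ s : ℝ, 0 < s → s ≤ 1 → ∀ u : (L : ℕ) → PhaseSpace L → ℝ,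
        (∀ L : ℕ, 2 ≤ L → ContDiff ℝ 2 (u L) ∧ MemLp (u L) 2 ((pinnedChain ω₂ lam β γ).gibbsMeasure L T) ∧
          ∀ x, (pinnedChain ω₂ lam β γ).flipGenerator L T T ε (u L) x =
            s * u L x - ∑ i : Fin L, (pinnedChain ω₂ lam β γ).bondCurrent L i x) →
        ∃ K : ℝ, Tendsto (fun L : ℕ => (∫ x, (∑ i : Fin L, (pinnedChain ω₂ lam β γ).bondCurrent L i x) * u L x
          ∂((pinnedChain ω₂ lam β γ).gibbsMeasure L T)) / ((L : ℝ) - 1)) atTop (𝓝 K))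
    (hSD : ∀ (ω₂ lam β γ T ε : ℝ), 0 < ω₂ → 0 < lam → 0 < β → 0 < γ → 0 < T → 0 < ε →
      ∃ a C : ℝ, 0 < a ∧ a ≤ 1 ∧ 0 ≤ C ∧ ∀ (L : ℕ), 2 ≤ L → ∀ s : ℝ, 0 < s → s ≤ 1 →
        ∀ u : PhaseSpace L → ℝ,
          (ContDiff ℝ 2 u ∧ MemLp u 2 ((pinnedChain ω₂ lam β γ).gibbsMeasure L T) ∧
            ∀ x, (pinnedChain ω₂ lam β γ).flipGenerator L T T ε u x =
              s * u x - ∑ i : Fin L, (pinnedChain ω₂ lam β γ).bondCurrent L i x) →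
          s * ∫ x, u x ^ 2 ∂((pinnedChain ω₂ lam β γ).gibbsMeasure L T) ≤ C * ((L : ℝ) - 1) * s ^ a)
    (hFloor : ∀ (ω₂ lam β γ T ε : ℝ), 0 < ω₂ → 0 < lam → 0 < β → 0 < γ → 0 < T → 0 < ε →
      ∃ c : ℝ, 0 < c ∧ ∃ L₀ : ℕ, ∀ (L : ℕ), L₀ ≤ L → 2 ≤ L → ∀ g : PhaseSpace L → ℝ,
        (ContDiff ℝ 2 g ∧ MemLp g 2 ((pinnedChain ω₂ lam β γ).gibbsMeasure L T) ∧
          ∀ x, (pinnedChain ω₂ lam β γ).flipGenerator L T T ε g x = -(kin L 0 x - T)) →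
        c ≤ ((L : ℝ) - 1) * (γ * (1 - γ / T ^ 2 *
          ∫ x, g x * (kin L 0 x - T) ∂((pinnedChain ω₂ lam β γ).gibbsMeasure L T)))) :
    ∀ (ω₂ lam β γ T ε : ℝ), 0 < ω₂ → 0 < lam → 0 < β → 0 < γ → 0 < T → 0 < ε → ∃ κ : ℝ, 0 < κ ∧
      ∀ g : (L : ℕ) → PhaseSpace L → ℝ,
        (∀ L : ℕ, 2 ≤ L → ContDiff ℝ 2 (g L) ∧ MemLp (g L) 2 ((pinnedChain ω₂ lam β γ).gibbsMeasure L T) ∧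
          ∀ x, (pinnedChain ω₂ lam β γ).flipGenerator L T T ε (g L) x = -(kin L 0 x - T)) →
        Tendsto (fun L : ℕ => ((L : ℝ) - 1) * (γ * (1 - γ / T ^ 2 *
          ∫ x, g L x * (kin L 0 x - T) ∂((pinnedChain ω₂ lam β γ).gibbsMeasure L T)))) atTop (𝓝 κ) := by
  intro ω₂ lam β γ T ε hω hl hβ hγ hT hε
  classical
  set P := pinnedChain ω₂ lam β γ with hP
  -- the forward-field predicate and the sequence of Kubo conductances
  set FF : (L : ℕ) → (PhaseSpace L → ℝ) → Prop := fun L g =>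
    ContDiff ℝ 2 g ∧ MemLp g 2 (P.gibbsMeasure L T) ∧
      ∀ x, P.flipGenerator L T T ε g x = -(kin L 0 x - T) with hFF
  set GK : (L : ℕ) → (PhaseSpace L → ℝ) → ℝ := fun L g =>
    ((L : ℝ) - 1) * (γ * (1 - γ / T ^ 2 * ∫ x, g x * (kin L 0 x - T) ∂(P.gibbsMeasure L T))) with hGK
  -- if some length carries no forward field, the claim is vacuous
  by_cases hex : ∀ L : ℕ, 2 ≤ L → ∃ g : PhaseSpace L → ℝ, FF L g
  swap
  · push Not at hex
    obtain ⟨L₀, hL₀, hno⟩ := hex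
    refine ⟨1, one_pos, fun g hg => ?_⟩
    exact absurd (hg L₀ hL₀) (hno (g L₀))
  -- a reference family of forward fields
  have hg0 : ∃ g0 : (L : ℕ) → PhaseSpace L → ℝ, ∀ L : ℕ, 2 ≤ L → FF L (g0 L) := by
    refine ⟨fun L => if h : 2 ≤ L then (hex L h).choose else fun _ => 0, fun L hL => ?_⟩
    simp only [dif_pos hL]
    exact (hex L hL).choose_spec
  obtain ⟨g0, hg0⟩ := hg0
  -- classical Abel correctors (A2, landed), junk `0` off `s > 0` or `L < 2`
  have hA2 := stub_abelCorrectorExists ω₂ lam β γ T ε hω hl hβ hγ hT hε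
  set uc : (L : ℕ) → ℝ → PhaseSpace L → ℝ := fun L s =>
    if h : 2 ≤ L ∧ 0 < s then (hA2 L h.1 s h.2).choose else fun _ => 0 with hucdef
  have huc : ∀ (L : ℕ), 2 ≤ L → ∀ s : ℝ, 0 < s →
      ContDiff ℝ 2 (uc L s) ∧ MemLp (uc L s) 2 (P.gibbsMeasure L T) ∧
        ∀ x, P.flipGenerator L T T ε (uc L s) x = s * uc L s x - ∑ i : Fin L, P.bondCurrent L i x := by
    intro L hL s hs
    have e : uc L s = (hA2 L hL s hs).choose := by simp only [hucdef, dif_pos (And.intro hL hs)]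
    rw [e]
    exact (hA2 L hL s hs).choose_spec
  -- the Abel-regularised per-bond Green–Kubo functional
  set K : ℕ → ℝ → ℝ := fun L s =>
    (∫ x, (∑ i : Fin L, P.bondCurrent L i x) * uc L s x ∂(P.gibbsMeasure L T)) / (T ^ 2 * ((L : ℝ) - 1))
    with hKdef
  have hT2 : 0 < T ^ 2 := by positivity
  -- Abel limits (A3, landed): `K_L(0⁺) = (L−1)·G_L[g]` for EVERY forward field `g`
  have habel_g : ∀ (L : ℕ), 2 ≤ L → ∀ g : PhaseSpace L → ℝ, FF L g →
      Tendsto (K L) (𝓝[>] 0) (𝓝 (GK L g)) := by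
    intro L hL g hg
    have hN1 : 0 < (L : ℝ) - 1 := by
      have : (2 : ℝ) ≤ L := by exact_mod_cast hL
      linarith
    have hden : T ^ 2 * ((L : ℝ) - 1) ≠ 0 := (mul_pos hT2 hN1).ne'
    have h := stub_abelLimit ω₂ lam β γ T ε hω hl hβ hγ hT hε L hL g hg (uc L)
      (fun s hs _ => huc L hL s hs)
    have h' := h.div_const (T ^ 2 * ((L : ℝ) - 1))
    have e : ((L : ℝ) - 1) ^ 2 * (γ * (T ^ 2 - γ * ∫ x, g x * (kin L 0 x - T) ∂(P.gibbsMeasure L T))) /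
        (T ^ 2 * ((L : ℝ) - 1)) = GK L g := by
      simp only [hGK]
      field_simp
    rw [e] at h'
    exact h'
  -- hence the reference sequence
  set D : ℕ → ℝ := fun L => GK L (g0 L) with hDdef
  have habel : ∀ᶠ L in atTop, Tendsto (K L) (𝓝[>] 0) (𝓝 (D L)) := by
    filter_upwards [eventually_ge_atTop 2] with L hL
    exact habel_g L hL (g0 L) (hg0 L hL)
  -- one-sided monotonicity in `s`, uniformly in `L` (M)
  obtain ⟨C₀, hC₀, hMono⟩ := stub_abelMonotone ω₂ lam β γ T ε hω hl hβ hγ hT hε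
  have hmono : ∀ᶠ L in atTop, ∀ s s' : ℝ, 0 < s → s ≤ s' → s' ≤ 1 →
      -(2 * C₀ / T ^ 2 * (s' - s)) ≤ K L s' - K L s := by
    filter_upwards [eventually_ge_atTop 2] with L hL s s' hs hss' _
    have hL2 : (2 : ℝ) ≤ L := by exact_mod_cast hL
    have hN1 : 0 < (L : ℝ) - 1 := by linarith
    have hden : 0 < T ^ 2 * ((L : ℝ) - 1) := mul_pos hT2 hN1
    have hs' : 0 < s' := lt_of_lt_of_le hs hss'
    have hb := hMono L hL s s' hs hss' (uc L s) (uc L s') (huc L hL s hs) (huc L hL s' hs')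
    have hK : K L s' - K L s =
        ((∫ x, (∑ i : Fin L, P.bondCurrent L i x) * uc L s' x ∂(P.gibbsMeasure L T)) -
          ∫ x, (∑ i : Fin L, P.bondCurrent L i x) * uc L s x ∂(P.gibbsMeasure L T)) /
          (T ^ 2 * ((L : ℝ) - 1)) := by
      simp only [hKdef]; ring
    rw [hK, le_div_iff₀ hden]
    have hLL : (L : ℝ) ≤ 2 * ((L : ℝ) - 1) := by linarith
    have hds : 0 ≤ s' - s := by linarith
    calc -(2 * C₀ / T ^ 2 * (s' - s)) * (T ^ 2 * ((L : ℝ) - 1)) = -(C₀ * (2 * ((L : ℝ) - 1)) * (s' - s)) := by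
          field_simp
      _ ≤ -(C₀ * L * (s' - s)) := by
          have : C₀ * L * (s' - s) ≤ C₀ * (2 * ((L : ℝ) - 1)) * (s' - s) :=
            mul_le_mul_of_nonneg_right (mul_le_mul_of_nonneg_left hLL hC₀) hds
          linarith
      _ ≤ (∫ x, (∑ i : Fin L, P.bondCurrent L i x) * uc L s' x ∂(P.gibbsMeasure L T)) -
            ∫ x, (∑ i : Fin L, P.bondCurrent L i x) * uc L s x ∂(P.gibbsMeasure L T) := hb
  -- upper Abel modulus at `0⁺`, uniformly in `L` (U)
  have hupper : ∀ η : ℝ, 0 < η → ∃ s₀ : ℝ, 0 < s₀ ∧ s₀ ≤ 1 ∧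
      ∀ᶠ L in atTop, ∀ s s' : ℝ, 0 < s → s ≤ s' → s' ≤ s₀ → K L s' - K L s ≤ η := by
    intro η hη
    obtain ⟨s₀, hs₀, hs₀1, L₀, hU⟩ :=
      (upperAbelModulus_of_storageDecay hSD) ω₂ lam β γ T ε hω hl hβ hγ hT hε (η * T ^ 2) (by positivity)
    refine ⟨s₀, hs₀, hs₀1, ?_⟩
    filter_upwards [eventually_ge_atTop 2, eventually_ge_atTop L₀] with L hL hL₀ s s' hs hss' hs'₀
    have hL2 : (2 : ℝ) ≤ L := by exact_mod_cast hL
    have hN1 : 0 < (L : ℝ) - 1 := by linarith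
    have hden : 0 < T ^ 2 * ((L : ℝ) - 1) := mul_pos hT2 hN1
    have hs' : 0 < s' := lt_of_lt_of_le hs hss'
    have hb := hU L hL₀ hL s s' hs hss' hs'₀ (uc L s) (uc L s') (huc L hL s hs) (huc L hL s' hs')
    have hK : K L s' - K L s =
        ((∫ x, (∑ i : Fin L, P.bondCurrent L i x) * uc L s' x ∂(P.gibbsMeasure L T)) -
          ∫ x, (∑ i : Fin L, P.bondCurrent L i x) * uc L s x ∂(P.gibbsMeasure L T)) /
          (T ^ 2 * ((L : ℝ) - 1)) := by
      simp only [hKdef]; ring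
    rw [hK, div_le_iff₀ hden]
    calc (∫ x, (∑ i : Fin L, P.bondCurrent L i x) * uc L s' x ∂(P.gibbsMeasure L T)) -
            ∫ x, (∑ i : Fin L, P.bondCurrent L i x) * uc L s x ∂(P.gibbsMeasure L T)
          ≤ η * T ^ 2 * ((L : ℝ) - 1) := hb
      _ = η * (T ^ 2 * ((L : ℝ) - 1)) := by ring
  -- thermodynamic limit at fixed s (A4)
  have htl : ∀ s : ℝ, 0 < s → s ≤ 1 → ∃ Λ : ℝ, Tendsto (fun L => K L s) atTop (𝓝 Λ) := by
    intro s hs hs1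
    obtain ⟨Kinf, hKinf⟩ := hA4 ω₂ lam β γ T ε hω hl hβ hγ hT hε s hs hs1
      (fun L => uc L s) (fun L hL => huc L hL s hs)
    refine ⟨Kinf / T ^ 2, ?_⟩
    have hfun : (fun L => K L s) = fun L : ℕ =>
        ((∫ x, (∑ i : Fin L, P.bondCurrent L i x) * uc L s x ∂(P.gibbsMeasure L T)) / ((L : ℝ) - 1)) / T ^ 2 := by
      funext L
      simp only [hKdef]
      rw [mul_comm, div_mul_eq_div_div]
    rw [hfun]
    exact hKinf.div_const _
  -- floor on the Kubo conductances `D L = GK L (g0 L)` (P)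
  obtain ⟨c, hc, L₀, hfl⟩ := hFloor ω₂ lam β γ T ε hω hl hβ hγ hT hε
  have hfloor : ∀ᶠ L in atTop, c ≤ D L := by
    filter_upwards [eventually_ge_atTop 2, eventually_ge_atTop L₀] with L hL hL₀
    have hb := hfl L hL₀ hL (g0 L) (hg0 L hL)
    simpa only [hDdef, hGK] using hb
  obtain ⟨κ, hκ, hconv⟩ :=
    abel_mooreOsgood_floorD K D (2 * C₀ / T ^ 2) c hc hmono hupper habel htl hfloor
  refine ⟨κ, hκ, fun g hg => ?_⟩
  -- the Kubo sequence of an arbitrary forward-field family IS the reference sequence (uniqueness of Abel limits)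
  have heq : ∀ᶠ L in atTop, GK L (g L) = D L := by
    filter_upwards [eventually_ge_atTop 2] with L hL
    haveI : (𝓝[>] (0 : ℝ)).NeBot := nhdsGT_neBot 0
    exact tendsto_nhds_unique (habel_g L hL (g L) (hg L hL)) (habel_g L hL (g0 L) (hg0 L hL))
  exact hconv.congr' (heq.mono fun L hL => hL.symm)



/-- **The line concludes the crux BY NAME from its three stubs**: A4 (fixed-`s` thermodynamic limit) →
U⁺ (zero-frequency storage decay) → P (Kubo conductance floor) → `VanishingNoiseTransfer.NoisyFourier`
(stmt-AtomisticToContinuum-11977), through `kuboLimit_of_storageDecayParts` and the landed closer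
`noisyFourier_of_kuboLimit` (c3, p127584). [folklore] -/
theorem noisyFourier_of_storageDecayParts
    (hA4 : ∀ (ω₂ lam β γ T ε : ℝ), 0 < ω₂ → 0 < lam → 0 < β → 0 < γ → 0 < T → 0 < ε →
      ∀ s : ℝ, 0 < s → s ≤ 1 → ∀ u : (L : ℕ) → PhaseSpace L → ℝ,
        (∀ L : ℕ, 2 ≤ L → ContDiff ℝ 2 (u L) ∧ MemLp (u L) 2 ((pinnedChain ω₂ lam β γ).gibbsMeasure L T) ∧
          ∀ x, (pinnedChain ω₂ lam β γ).flipGenerator L T T ε (u L) x =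
            s * u L x - ∑ i : Fin L, (pinnedChain ω₂ lam β γ).bondCurrent L i x) →
        ∃ K : ℝ, Tendsto (fun L : ℕ => (∫ x, (∑ i : Fin L, (pinnedChain ω₂ lam β γ).bondCurrent L i x) * u L x
          ∂((pinnedChain ω₂ lam β γ).gibbsMeasure L T)) / ((L : ℝ) - 1)) atTop (𝓝 K))
    (hSD : ∀ (ω₂ lam β γ T ε : ℝ), 0 < ω₂ → 0 < lam → 0 < β → 0 < γ → 0 < T → 0 < ε →
      ∃ a C : ℝ, 0 < a ∧ a ≤ 1 ∧ 0 ≤ C ∧ ∀ (L : ℕ), 2 ≤ L → ∀ s : ℝ, 0 < s → s ≤ 1 →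
        ∀ u : PhaseSpace L → ℝ,
          (ContDiff ℝ 2 u ∧ MemLp u 2 ((pinnedChain ω₂ lam β γ).gibbsMeasure L T) ∧
            ∀ x, (pinnedChain ω₂ lam β γ).flipGenerator L T T ε u x =
              s * u x - ∑ i : Fin L, (pinnedChain ω₂ lam β γ).bondCurrent L i x) →
          s * ∫ x, u x ^ 2 ∂((pinnedChain ω₂ lam β γ).gibbsMeasure L T) ≤ C * ((L : ℝ) - 1) * s ^ a)
    (hFloor : ∀ (ω₂ lam β γ T ε : ℝ), 0 < ω₂ → 0 < lam → 0 < β → 0 < γ → 0 < T → 0 < ε →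
      ∃ c : ℝ, 0 < c ∧ ∃ L₀ : ℕ, ∀ (L : ℕ), L₀ ≤ L → 2 ≤ L → ∀ g : PhaseSpace L → ℝ,
        (ContDiff ℝ 2 g ∧ MemLp g 2 ((pinnedChain ω₂ lam β γ).gibbsMeasure L T) ∧
          ∀ x, (pinnedChain ω₂ lam β γ).flipGenerator L T T ε g x = -(kin L 0 x - T)) →
        c ≤ ((L : ℝ) - 1) * (γ * (1 - γ / T ^ 2 *
          ∫ x, g x * (kin L 0 x - T) ∂((pinnedChain ω₂ lam β γ).gibbsMeasure L T)))) :
    NoisyFourier :=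
  Summit.AtomisticToContinuum.FouriersLaw.Theorems.NoisyFourier.LineAssembly.noisyFourier_of_kuboLimit
    (kuboLimit_of_storageDecayParts hA4 hSD hFloor)

/-! ## Registered helper (notation-free restatement) -/

/-- Registered helper sub-goal `helper_noisyFourierOfStorageDecayParts` of crux stmt-AtomisticToContinuum-11977 (line
`abel-storage-decay`, lead c6): the COMPOSITION — the three registered stubs `stub_fixedAbelThermodynamicLimit` (A4),
`stub_zeroFrequencyStorageDecay` (U⁺), `stub_kuboConductanceFloor` (P), as hypotheses, imply
`VanishingNoiseTransfer.NoisyFourier` by name (`noisyFourier_of_storageDecayParts`, restated); this is also landed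
glue for the strategist's certified split of the crux into {A4, U⁺/U, P}. [folklore] -/
theorem helper_noisyFourierOfStorageDecayParts : (∀ (ω₂ lam β γ T ε : ℝ), 0 < ω₂ → 0 < lam → 0 < β → 0 < γ → 0 < T → 0 < ε → ∀ s : ℝ, 0 < s → s ≤ 1 → ∀ u : (L : ℕ) → Literature.MathematicalPhysics.KineticTheory.HeatConduction.PhaseSpace L → ℝ, (∀ L : ℕ, 2 ≤ L → ContDiff ℝ 2 (u L) ∧ MeasureTheory.MemLp (u L) 2 ((Literature.MathematicalPhysics.KineticTheory.HeatConduction.pinnedChain ω₂ lam β γ).gibbsMeasure L T) ∧ ∀ x, (Literature.MathematicalPhysics.KineticTheory.HeatConduction.pinnedChain ω₂ lam β γ).flipGenerator L T T ε (u L) x = s * u L x - ∑ i : Fin L, (Literature.MathematicalPhysics.KineticTheory.HeatConduction.pinnedChain ω₂ lam β γ).bondCurrent L i x) → ∃ K : ℝ, Filter.Tendsto (fun L : ℕ => (MeasureTheory.integral ((Literature.MathematicalPhysics.KineticTheory.HeatConduction.pinnedChain ω₂ lam β γ).gibbsMeasure L T) (fun x => (∑ i : Fin L, (Literature.MathematicalPhysics.KineticTheory.HeatConduction.pinnedChain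 ω₂ lam β γ).bondCurrent L i x) * u L x)) / ((L : ℝ) - 1)) Filter.atTop (nhds K)) → (∀ (ω₂ lam β γ T ε : ℝ), 0 < ω₂ → 0 < lam → 0 < β → 0 < γ → 0 < T → 0 < ε → ∃ a C : ℝ, 0 < a ∧ a ≤ 1 ∧ 0 ≤ C ∧ ∀ (L : ℕ), 2 ≤ L → ∀ s : ℝ, 0 < s → s ≤ 1 → ∀ u : Literature.MathematicalPhysics.KineticTheory.HeatConduction.PhaseSpace L → ℝ, (ContDiff ℝ 2 u ∧ MeasureTheory.MemLp u 2 ((Literature.MathematicalPhysics.KineticTheory.HeatConduction.pinnedChain ω₂ lam β γ).gibbsMeasure L T) ∧ ∀ x, (Literature.MathematicalPhysics.KineticTheory.HeatConduction.pinnedChain ω₂ lam β γ).flipGenerator L T T ε u x = s * u x - ∑ i : Fin L, (Literature.MathematicalPhysics.KineticTheory.HeatConduction.pinnedChain ω₂ lam β γ).bondCurrent L i x) → s * MeasureTheory.integral ((Literature.MathematicalPhysics.KineticTheory.HeatConduction.pinnedChain ω₂ lam β γ).gibbsMeasure L T) (fun x => u x ^ 2) ≤ C * ((L : ℝ) - 1)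 * s ^ a) → (∀ (ω₂ lam β γ T ε : ℝ), 0 < ω₂ → 0 < lam → 0 < β → 0 < γ → 0 < T → 0 < ε → ∃ c : ℝ, 0 < c ∧ ∃ L₀ : ℕ, ∀ (L : ℕ), L₀ ≤ L → 2 ≤ L → ∀ g : Literature.MathematicalPhysics.KineticTheory.HeatConduction.PhaseSpace L → ℝ, (ContDiff ℝ 2 g ∧ MeasureTheory.MemLp g 2 ((Literature.MathematicalPhysics.KineticTheory.HeatConduction.pinnedChain ω₂ lam β γ).gibbsMeasure L T) ∧ ∀ x, (Literature.MathematicalPhysics.KineticTheory.HeatConduction.pinnedChain ω₂ lam β γ).flipGenerator L T T ε g x = -(Summit.AtomisticToContinuum.FouriersLaw.Theorems.SuperadditiveResistance.DeviceLiouville.kin L 0 x - T)) → c ≤ ((L : ℝ) - 1) * (γ * (1 - γ / T ^ 2 * MeasureTheory.integral ((Literature.MathematicalPhysics.KineticTheory.HeatConduction.pinnedChain ω₂ lam β γ).gibbsMeasure L T) (fun x => g x * (Summit.AtomisticToContinuum.FouriersLaw.Theorems.SuperadditiveResistance.DeviceLiouville.kin L 0 x - T))))) → Summit.AtomisticToContinuum.FouriersLaw.Theses.VanishingNoiseTransfer.NoisyFourier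 :=
  fun hA4 hSD hFloor => noisyFourier_of_storageDecayParts hA4 hSD hFloor

end Summit.AtomisticToContinuum.FouriersLaw.Theorems.NoisyFourier.StorageDecay

end
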